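import Literature.NumberTheory.BeurlingPrimes.HilberdinkMellin
import Literature.NumberTheory.BeurlingPrimes.IntegerCounting
import Literature.NumberTheory.BeurlingPrimes.WellBehavedIntegers
import HarnessLib

/-!
# Landau's continuation of `ζ_P` from `N_P(x) = ρx + O(x^β)`: discharge of `MontgomeryVaughan2007_zetaContinuation`

Topic `Literature/NumberTheory/BeurlingPrimes`. Everything in this file is PROVED; it DISCHARGES the
named fact `Literature.NumberTheory.BeurlingPrimes.MontgomeryVaughan2007_zetaContinuation` of
`WellBehavedIntegers.lean` (`MontgomeryVaughan2007_zetaContinuation_holds`).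

With `E(x) = N_P(x) − ρx`, `|E(x)| ≤ Cx^β` (`x ≥ 1`, `β < 1`, `ρ > 0`) and
`I(s) = ∫₁^∞ E(x)x^{−s−1} dx = mellin (Hilberdink.errN P ρ) (−s)` (tree, `HilberdinkMellin.lean`:
holomorphic on `Re s > β`, `‖I(s)‖ ≤ C/(Re s − β)`, `sI(s) = ζ_P(s) − ρs/(s−1)` on `Re s > 1`), the
continuation is `Z(s) = ρs/(s−1) + sI(s)` (`intZeta`, DEFINED here; the tree's `Hilberdink.Ztilde`
is `(s−1)Z(s)`): it equals `ζ_P(s)` for `Re s > 1`, is holomorphic on `{Re s > β} ∖ {1}` with the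
single simple pole `ρs/(s−1)`, satisfies `‖Z(s)‖ ≤ (2ρ + C + C(|β|+1)/δ)|t|` for `Re s ≥ β + δ`, `|t| ≥ 1`
(Montgomery–Vaughan: "`ζ_K(s) ≪ |t|` uniformly for `σ ≥ 1 − 1/d + δ`, `|t| ≥ 1`"), and
`‖Z(s) − 1‖ ≤ λ₀^{−(σ−2)} ζ_P(2)` for `σ ≥ 2`, so `Z(s) → 1` as `σ → +∞` uniformly in `t`.
Also: the punctured half-plane `{Re s > β} ∖ {1}` is preconnected, so ANY two continuations of `ζ_P`
agree there (`BeurlingPrimes.IsZetaContinuation.eqOn`, identity theorem) — in particular every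
continuation is `Z`.

## References
* [MontgomeryVaughan2007] H. L. Montgomery, R. C. Vaughan, *Multiplicative Number Theory I*, CUP 2007,
  §8.4 pp. 266–268 (read).
* [Hilberdink2007] T. W. Hilberdink, J. Number Theory 122 (2007) 336–341, §1 p. 337 (read).
-/

noncomputable section

open Set Filter MeasureTheory Complex Topology
open scoped Topology

namespace Literature.NumberTheory.BeurlingPrimes

open Literature.Barriers.RiemannHypothesis

variable (P : BeurlingPrimes)

/-- **Landau's continuation** `Z(s) = ρs/(s−1) + s∫₁^∞ (N_P(x) − ρx)x^{−s−1} dx`, the error integral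
being the tree's `mellin (Hilberdink.errN P ρ) (−s)`; `(s − 1)Z(s)` is the tree's `Hilberdink.Ztilde`.
[cite: MontgomeryVaughan2007, §8.4, proof of Thm 8.10] -/
def _root_.Literature.Barriers.RiemannHypothesis.BeurlingPrimes.intZeta (ρ : ℝ) (s : ℂ) : ℂ :=
  ρ * s / (s - 1) + s * mellin (Hilberdink.errN P ρ) (-s)

variable {P}

/-- `Z = ζ_P` on `Re s > 1` (tree: `Hilberdink.mul_mellin_errN_eq`, `sI(s) = ζ_P(s) − ρs/(s−1)`).
[cite: MontgomeryVaughan2007, §8.4, proof of Thm 8.10] -/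
theorem intZeta_eq_zeta {ρ C β : ℝ} (hβ : β < 1)
    (hN : ∀ x : ℝ, 1 ≤ x → |(P.intCount x : ℝ) - ρ * x| ≤ C * x ^ β) {s : ℂ} (hs : 1 < s.re) :
    P.intZeta ρ s = P.zeta s := by
  rw [BeurlingPrimes.intZeta,
    Hilberdink.mul_mellin_errN_eq (Hilberdink.intCount_le_of_abs_le P hβ.le hN) ρ hs]
  ring

/-- `(s − 1)Z(s) = Z̃(s)` for `s ≠ 1`. [folklore] -/
theorem sub_one_mul_intZeta (ρ : ℝ) {s : ℂ} (hs : s ≠ 1) :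
    (s - 1) * P.intZeta ρ s = Hilberdink.Ztilde P ρ s := by
  have hs1 : s - 1 ≠ 0 := sub_ne_zero.mpr hs
  rw [BeurlingPrimes.intZeta, Hilberdink.Ztilde]
  field_simp

/-- `Z` is holomorphic on `{Re s > β} ∖ {1}`. [cite: MontgomeryVaughan2007, §8.4 p. 266] -/
theorem differentiableOn_intZeta {ρ C β : ℝ}
    (hN : ∀ x : ℝ, 1 ≤ x → |(P.intCount x : ℝ) - ρ * x| ≤ C * x ^ β) :
    DifferentiableOn ℂ (P.intZeta ρ) {s : ℂ | β < s.re ∧ s ≠ 1} := by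
  intro s hs
  have hs1 : s - 1 ≠ 0 := sub_ne_zero.mpr hs.2
  have h1 : DifferentiableAt ℂ (fun s : ℂ ↦ (ρ : ℂ) * s / (s - 1)) s :=
    ((differentiableAt_const _).mul differentiableAt_id).div (differentiableAt_id.sub_const 1) hs1
  have h2 : DifferentiableAt ℂ (fun s ↦ s * mellin (Hilberdink.errN P ρ) (-s)) s :=
    differentiableAt_id.mul ((Hilberdink.differentiableOn_mellin_errN hN).differentiableAt
      ((isOpen_lt continuous_const continuous_re).mem_nhds hs.1))
  exact (h1.add h2).differentiableWithinAt

/-- `Z` is an analytic continuation of `ζ_P` to `{Re s > β} ∖ {1}`. [cite: MontgomeryVaughan2007, §8.4 p. 266] -/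
theorem isZetaContinuation_intZeta {ρ C β : ℝ} (hβ : β < 1)
    (hN : ∀ x : ℝ, 1 ≤ x → |(P.intCount x : ℝ) - ρ * x| ≤ C * x ^ β) :
    P.IsZetaContinuation β (P.intZeta ρ) :=
  ⟨fun _ hs ↦ intZeta_eq_zeta hβ hN hs, differentiableOn_intZeta hN⟩

/-! ### Uniqueness of the continuation -/

/-- The punctured half-plane `{Re s > β} ∖ {1}` is preconnected (union of the convex pieces
`Im s > 0`, `Im s < 0`, `Re s > max(β,1)`, `β < Re s < 1`, consecutive ones meeting). [folklore] -/
theorem isPreconnected_puncturedHalfPlane (β : ℝ) :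
    IsPreconnected {s : ℂ | β < s.re ∧ s ≠ 1} := by
  set A : Set ℂ := {s : ℂ | β < s.re} ∩ {s : ℂ | 0 < s.im} with hA
  set B : Set ℂ := {s : ℂ | β < s.re} ∩ {s : ℂ | s.im < 0} with hB
  set Rt : Set ℂ := {s : ℂ | max β 1 < s.re} with hRt
  set Lf : Set ℂ := {s : ℂ | β < s.re} ∩ {s : ℂ | s.re < 1} with hLf
  have hAc : IsPreconnected A :=
    ((convex_halfSpace_re_gt β).inter (convex_halfSpace_im_gt 0)).isPreconnected
  have hBc : IsPreconnected B :=
    ((convex_halfSpace_re_gt β).inter (convex_halfSpace_im_lt 0)).isPreconnected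
  have hRtc : IsPreconnected Rt := (convex_halfSpace_re_gt _).isPreconnected
  have hLfc : IsPreconnected Lf :=
    ((convex_halfSpace_re_gt β).inter (convex_halfSpace_re_lt 1)).isPreconnected
  have hU : {s : ℂ | β < s.re ∧ s ≠ 1} = ((Rt ∪ A) ∪ B) ∪ Lf := by
    ext s
    simp only [mem_setOf_eq, mem_union, mem_inter_iff, hRt, hA, hB, hLf, max_lt_iff]
    constructor
    · rintro ⟨hs, hs1⟩
      rcases lt_trichotomy s.im 0 with him | him | him
      · exact Or.inl (Or.inr ⟨hs, him⟩)
      · have hre : s.re ≠ 1 := fun h ↦ hs1 (Complex.ext (by simp [h]) (by simp [him]))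
        rcases lt_or_gt_of_ne hre with hlt | hlt
        · exact Or.inr ⟨hs, hlt⟩
        · exact Or.inl (Or.inl (Or.inl ⟨hs, hlt⟩))
      · exact Or.inl (Or.inl (Or.inr ⟨hs, him⟩))
    · rintro (((⟨hs, h1⟩ | ⟨hs, him⟩) | ⟨hs, him⟩) | ⟨hs, hlt⟩)
      · exact ⟨hs, fun h ↦ by rw [h] at h1; simp at h1⟩
      · exact ⟨hs, fun h ↦ by rw [h] at him; simp at him⟩
      · exact ⟨hs, fun h ↦ by rw [h] at him; simp at him⟩
      · exact ⟨hs, fun h ↦ by rw [h] at hlt; simp at hlt⟩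
  rw [hU]
  set p : ℂ := ((max β 1 + 1 : ℝ) : ℂ) + I with hp
  set q : ℂ := ((max β 1 + 1 : ℝ) : ℂ) - I with hq
  have hp_re : p.re = max β 1 + 1 := by simp [hp]
  have hp_im : p.im = 1 := by simp [hp]
  have hq_re : q.re = max β 1 + 1 := by simp [hq]
  have hq_im : q.im = -1 := by simp [hq]
  have hmax := le_max_left β 1
  have h1 : IsPreconnected (Rt ∪ A) :=
    hRtc.union p (by simp only [hRt, mem_setOf_eq, hp_re]; linarith)
      ⟨by simp only [mem_setOf_eq, hp_re]; linarith, by simp only [mem_setOf_eq, hp_im]; norm_num⟩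
      hAc
  have h2 : IsPreconnected ((Rt ∪ A) ∪ B) :=
    h1.union q (Or.inl (by simp only [hRt, mem_setOf_eq, hq_re]; linarith))
      ⟨by simp only [mem_setOf_eq, hq_re]; linarith, by simp only [mem_setOf_eq, hq_im]; norm_num⟩
      hBc
  by_cases hβ : β < 1
  · set r : ℂ := (((β + 1) / 2 : ℝ) : ℂ) + I with hr
    have hr_re : r.re = (β + 1) / 2 := by simp [hr]
    have hr_im : r.im = 1 := by simp [hr]
    exact h2.union r
      (Or.inl (Or.inr ⟨by simp only [mem_setOf_eq, hr_re]; linarith,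
        by simp only [mem_setOf_eq, hr_im]; norm_num⟩))
      ⟨by simp only [mem_setOf_eq, hr_re]; linarith, by simp only [mem_setOf_eq, hr_re]; linarith⟩
      hLfc
  · have hempty : Lf = ∅ := by
      ext s
      simp only [hLf, mem_inter_iff, mem_setOf_eq, mem_empty_iff_false, iff_false, not_and,
        not_lt]
      intro hs
      linarith
    rw [hempty, union_empty]
    exact h2

/-- **Uniqueness of the continuation.** Two analytic continuations of `ζ_P` to `{Re s > β} ∖ {1}`
agree there (identity theorem on the preconnected open set; they agree on `Re s > 1`). [folklore] -/
theorem _root_.Literature.Barriers.RiemannHypothesis.BeurlingPrimes.IsZetaContinuation.eqOn {β : ℝ} {Z₁ Z₂ : ℂ → ℂ} (h₁ : P.IsZetaContinuation β Z₁)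
    (h₂ : P.IsZetaContinuation β Z₂) : EqOn Z₁ Z₂ {s : ℂ | β < s.re ∧ s ≠ 1} := by
  have hU : IsOpen {s : ℂ | β < s.re ∧ s ≠ 1} :=
    (isOpen_lt continuous_const continuous_re).inter isOpen_ne
  have ha₁ : AnalyticOnNhd ℂ Z₁ {s : ℂ | β < s.re ∧ s ≠ 1} := h₁.2.analyticOnNhd hU
  have ha₂ : AnalyticOnNhd ℂ Z₂ {s : ℂ | β < s.re ∧ s ≠ 1} := h₂.2.analyticOnNhd hU
  set z₀ : ℂ := ((max β 1 + 1 : ℝ) : ℂ) with hz₀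
  have hz₀re : z₀.re = max β 1 + 1 := by simp [hz₀]
  have hz₀U : z₀ ∈ {s : ℂ | β < s.re ∧ s ≠ 1} := by
    refine ⟨by rw [hz₀re]; linarith [le_max_left β 1], fun h ↦ ?_⟩
    have := congrArg Complex.re h
    rw [hz₀re, one_re] at this
    linarith [le_max_right β 1]
  have hev : Z₁ =ᶠ[𝓝 z₀] Z₂ := by
    have h1lt : 1 < z₀.re := by rw [hz₀re]; linarith [le_max_right β 1]
    filter_upwards [(isOpen_lt continuous_const continuous_re).mem_nhds h1lt] with s hs
    rw [h₁.1 s hs, h₂.1 s hs]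
  exact ha₁.eqOn_of_preconnected_of_eventuallyEq ha₂ (isPreconnected_puncturedHalfPlane β) hz₀U hev

/-! ### Growth of the continuation -/

/-- `‖ρs/(s−1)‖ ≤ 2ρ` when `|Im s| ≥ 1` (`ρ ≥ 0`). [folklore] -/
theorem norm_pole_term_le {ρ : ℝ} (hρ : 0 ≤ ρ) {s : ℂ} (ht : 1 ≤ |s.im|) :
    ‖(ρ : ℂ) * s / (s - 1)‖ ≤ 2 * ρ := by
  have hs1 : 1 ≤ ‖s - 1‖ := by
    have h := abs_im_le_norm (s - 1)
    simp only [sub_im, one_im, sub_zero] at h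
    linarith
  have hs_le : ‖s‖ ≤ ‖s - 1‖ + 1 := by
    have := norm_add_le (s - 1) 1
    rwa [sub_add_cancel, norm_one] at this
  rw [norm_div, norm_mul, Complex.norm_real, Real.norm_of_nonneg hρ,
    div_le_iff₀ (by linarith)]
  nlinarith [norm_nonneg (s - 1)]

/-- **Finite order: `‖Z(s)‖ ≤ (2ρ + C + C(|β|+1)/δ)·|t|` for `Re s ≥ β + δ`, `|t| ≥ 1`**
("`ζ_K(s) ≪ |t|` uniformly for `σ ≥ 1 − 1/d + δ`, `|t| ≥ 1`"; here `‖I(s)‖ ≤ C/(σ − β)` and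
`‖s‖ ≤ (σ − β) + |β| + |t|`). [cite: MontgomeryVaughan2007, §8.4 p. 266] -/
theorem norm_intZeta_le {ρ C β : ℝ} (hρ : 0 ≤ ρ)
    (hN : ∀ x : ℝ, 1 ≤ x → |(P.intCount x : ℝ) - ρ * x| ≤ C * x ^ β) {δ : ℝ} (hδ : 0 < δ) {s : ℂ}
    (hs : β + δ ≤ s.re) (ht : 1 ≤ |s.im|) :
    ‖P.intZeta ρ s‖ ≤ (2 * ρ + C + C * (|β| + 1) / δ) * |s.im| := by
  have hC : 0 ≤ C := Hilberdink.const_nonneg hN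
  set d : ℝ := s.re - β with hd
  have hdδ : δ ≤ d := by rw [hd]; linarith
  have hd0 : 0 < d := lt_of_lt_of_le hδ hdδ
  have hI : ‖mellin (Hilberdink.errN P ρ) (-s)‖ ≤ C / d :=
    Hilberdink.norm_mellin_errN_le hN (by rw [hd] at hd0; linarith)
  -- `‖s‖ ≤ d + |β| + |t|`
  have hs_norm : ‖s‖ ≤ d + |β| + |s.im| := by
    have h1 : ‖s‖ ≤ |s.re| + |s.im| := norm_le_abs_re_add_abs_im s
    have h2 : |s.re| ≤ d + |β| := by
      have := abs_add_le (s.re - β) β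
      rw [sub_add_cancel, abs_of_pos hd0] at this
      exact this
    linarith
  -- `‖s‖ · C/d ≤ C + (|β| + 1)|t| C/δ`
  have key : ‖s‖ * (C / d) ≤ C + (|β| + 1) * |s.im| * C / δ := by
    have e1 : ‖s‖ * (C / d) ≤ (d + |β| + |s.im|) * (C / d) :=
      mul_le_mul_of_nonneg_right hs_norm (div_nonneg hC hd0.le)
    have e2 : (d + |β| + |s.im|) * (C / d) = C + (|β| + |s.im|) * C / d := by
      field_simp
      ring
    have e3 : (|β| + |s.im|) * C / d ≤ (|β| + |s.im|) * C / δ :=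
      div_le_div_of_nonneg_left (by positivity) hδ hdδ
    have e4 : (|β| + |s.im|) * C / δ ≤ (|β| + 1) * |s.im| * C / δ := by
      refine div_le_div_of_nonneg_right (mul_le_mul_of_nonneg_right ?_ hC) hδ.le
      nlinarith [abs_nonneg β]
    linarith
  have t2 : ‖s * mellin (Hilberdink.errN P ρ) (-s)‖ ≤ C + (|β| + 1) * |s.im| * C / δ := by
    rw [norm_mul]
    exact (mul_le_mul_of_nonneg_left hI (norm_nonneg s)).trans key
  have t1 := norm_pole_term_le hρ ht (s := s)
  calc ‖P.intZeta ρ s‖ ≤ ‖(ρ : ℂ) * s / (s - 1)‖ + ‖s * mellin (Hilberdink.errN P ρ) (-s)‖ :=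
        norm_add_le _ _
    _ ≤ 2 * ρ + (C + (|β| + 1) * |s.im| * C / δ) := add_le_add t1 t2
    _ ≤ (2 * ρ + C + C * (|β| + 1) / δ) * |s.im| := by
        have h1 : (2 * ρ + C) * 1 ≤ (2 * ρ + C) * |s.im| :=
          mul_le_mul_of_nonneg_left ht (by linarith)
        have h2 : (|β| + 1) * |s.im| * C / δ = C * (|β| + 1) / δ * |s.im| := by ring
        linarith

/-- **`ζ_P(s) → 1` as `σ → ∞`: `‖ζ_P(s) − 1‖ ≤ λ₀^{−(σ−2)} ∑_k (genInt k)^{−2}` for `σ ≥ 2`**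
(each term `n^{−σ} = n^{−2} n^{−(σ−2)} ≤ n^{−2} λ₀^{−(σ−2)}` for `n ≠ 1`, as `n ≥ λ₀`). [folklore] -/
theorem norm_zeta_sub_one_le {K : ℝ} (hK : ∀ x : ℝ, 1 ≤ x → (P.intCount x : ℝ) ≤ K * x) {s : ℂ}
    (hs : 2 ≤ s.re) :
    ‖P.zeta s - 1‖ ≤ P.prime 0 ^ (-(s.re - 2)) * ∑' k : ℕ →₀ ℕ, P.genInt k ^ (-(2 : ℝ)) := by
  classical
  set f : (ℕ →₀ ℕ) → ℂ := fun k ↦ ((P.genInt k : ℝ) : ℂ) ^ (-s) with hf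
  have hsum : HasSum f (P.zeta s) :=
    P.hasSum_zeta (by linarith) (Hilberdink.summable_prime_rpow P hK (by linarith))
  have hf0 : f 0 = 1 := by simp [hf]
  have hupd : HasSum (Function.update f 0 0) (P.zeta s - 1) := by
    have h := hsum.update 0 0
    have h1 : (0 : ℂ) - f 0 + P.zeta s = P.zeta s - 1 := by rw [hf0]; ring
    rwa [h1] at h
  have hS : HasSum (fun k : ℕ →₀ ℕ ↦ P.prime 0 ^ (-(s.re - 2)) * P.genInt k ^ (-(2 : ℝ)))
      (P.prime 0 ^ (-(s.re - 2)) * ∑' k : ℕ →₀ ℕ, P.genInt k ^ (-(2 : ℝ))) :=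
    (P.summable_genInt_rpow hK (by norm_num : (1 : ℝ) < 2)).hasSum.mul_left _
  rw [← hupd.tsum_eq]
  refine tsum_of_norm_bounded hS fun k ↦ ?_
  by_cases hk : k = 0
  · subst hk
    rw [Function.update_self, norm_zero]
    exact mul_nonneg (Real.rpow_nonneg (P.prime_pos 0).le _)
      (Real.rpow_nonneg (P.genInt_pos 0).le _)
  · rw [Function.update_of_ne hk, hf]
    simp only
    rw [norm_cpow_eq_rpow_re_of_pos (P.genInt_pos k), neg_re]
    have hg : P.prime 0 ≤ P.genInt k := P.prime_zero_le_genInt hk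
    have hg0 : 0 < P.genInt k := P.genInt_pos k
    calc P.genInt k ^ (-s.re) = P.genInt k ^ (-(2 : ℝ)) * P.genInt k ^ (-(s.re - 2)) := by
          rw [← Real.rpow_add hg0]
          congr 1
          ring
      _ ≤ P.genInt k ^ (-(2 : ℝ)) * P.prime 0 ^ (-(s.re - 2)) :=
          mul_le_mul_of_nonneg_left (Real.rpow_le_rpow_of_nonpos (P.prime_pos 0) hg (by linarith))
            (Real.rpow_nonneg hg0.le _)
      _ = P.prime 0 ^ (-(s.re - 2)) * P.genInt k ^ (-(2 : ℝ)) := mul_comm _ _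

/-- `λ₀^{−(σ−2)} S → 0` as `σ → ∞`: for `ε > 0` there is `σ₁ ≥ 2` beyond which
`λ₀^{−(σ−2)} S < ε`. [folklore] -/
theorem exists_prime_rpow_mul_lt (P : BeurlingPrimes) (S : ℝ) {ε : ℝ} (hε : 0 < ε) :
    ∃ σ₁ : ℝ, 2 ≤ σ₁ ∧ ∀ σ : ℝ, σ₁ ≤ σ → P.prime 0 ^ (-(σ - 2)) * S < ε := by
  have hp := P.prime_pos 0
  have hb1 : (P.prime 0)⁻¹ < 1 := inv_lt_one_of_one_lt₀ P.one_lt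
  have hb0 : 0 < (P.prime 0)⁻¹ := inv_pos.mpr hp
  have h1 : Tendsto (fun x : ℝ ↦ (P.prime 0)⁻¹ ^ x) atTop (𝓝 0) :=
    tendsto_rpow_atTop_of_base_lt_one _ (by linarith) hb1
  have h2 : Tendsto (fun σ : ℝ ↦ σ - 2) atTop atTop := tendsto_atTop_add_const_right _ _ tendsto_id
  have h3 : Tendsto (fun σ : ℝ ↦ (P.prime 0)⁻¹ ^ (σ - 2) * S) atTop (𝓝 (0 * S)) :=
    (h1.comp h2).mul_const S
  rw [zero_mul] at h3
  obtain ⟨N, hN⟩ := eventually_atTop.mp ((tendsto_order.1 h3).2 ε hε)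
  refine ⟨max N 2, le_max_right _ _, fun σ hσ ↦ ?_⟩
  have := hN σ ((le_max_left _ _).trans hσ)
  rwa [Real.inv_rpow hp.le, ← Real.rpow_neg hp.le] at this

/-- **Discharge of `MontgomeryVaughan2007_zetaContinuation`** (Landau 1903; Montgomery–Vaughan 2007,
§8.4): under `|N_P(x) − ρx| ≤ Cx^β` (`ρ > 0`, `β < 1`), (a) `∑_j λ_j^{−σ} < ∞` for `σ > 1`;
(b) `Z(s) = ρs/(s−1) + sI(s)` continues `ζ_P` to `{Re s > β} ∖ {1}` with `sI(s)` holomorphic on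
`Re s > β`; (c) `‖Z(s)‖ ≤ C_δ|t|` for `Re s ≥ β + δ`, `|t| ≥ 1`; (d) `Z(s) → 1` as `σ → ∞`
uniformly. [cite: MontgomeryVaughan2007, §8.4 pp. 266–267 and proof of Thm 8.10] -/
theorem MontgomeryVaughan2007_zetaContinuation_holds : MontgomeryVaughan2007_zetaContinuation := by
  intro P ρ β hρ hβ hN
  obtain ⟨C, hC⟩ := hN
  have hK := Hilberdink.intCount_le_of_abs_le P hβ.le hC
  refine ⟨fun σ hσ ↦ Hilberdink.summable_prime_rpow P hK hσ, P.intZeta ρ,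
    isZetaContinuation_intZeta hβ hC,
    ⟨fun s ↦ s * mellin (Hilberdink.errN P ρ) (-s),
      differentiableOn_id.mul (Hilberdink.differentiableOn_mellin_errN hC), fun s _ _ ↦ rfl⟩, ?_, ?_⟩
  · intro δ hδ
    exact ⟨2 * ρ + C + C * (|β| + 1) / δ, fun s hs ht ↦ norm_intZeta_le hρ.le hC hδ hs ht⟩
  · intro ε hε
    obtain ⟨σ₁, hσ₁2, hσ₁⟩ := exists_prime_rpow_mul_lt P (∑' k : ℕ →₀ ℕ, P.genInt k ^ (-(2 : ℝ))) hε
    refine ⟨σ₁, fun s hs ↦ ?_⟩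
    have hs2 : 2 ≤ s.re := hσ₁2.trans hs
    rw [intZeta_eq_zeta hβ hC (by linarith)]
    exact ((norm_zeta_sub_one_le hK hs2).trans (hσ₁ s.re hs).le)

end Literature.NumberTheory.BeurlingPrimes

end
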